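import Summits.QuantumFields.YangMills.Theorems.BalabanUVNodesPortS1LZdetTwinObjects
import Literature.MathematicalPhysics.QuantumFieldTheory.Balaban1983to89.B13ScaleTransfer

/-!
# NODE O port PT-A, offer (ζ) for `stub_G3C` of 27930 — THE INTEGER TWIN OF THE WALK PIECES: `g3cWZ F Mc TZY x : IntFormula`, the print-side («universal window») reading of the
# hand's localized walk expansion `g3cW` ∕ `g3cEG` (✓`…PortS1G3CWalks`) — DEFINITIONS

Cell `ym-nodeO-ideate`, porter seat `ymgap-nodeO-port-PTA-1` (gen 8, lead of the registered line `pta_residueW`), on ★★★ director-ym №573 (2) «(ζ) GO NOW»; `--supports stmt-QuantumFields-27930`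
(helper, P0-free).  [I] = [Balaban1987RG1], [B9] = [Balaban1985BackgroundPropagators], [16] = [Balaban1985UV3].

WHAT.  Row (gZ) of `G3CPiecesAt` asks for ONE integer formula `EGZ x` (all volumes) with `IsLocal (L^{k+1}·Mc)`, `IsGaugeInv`, and, OFF the centred wrap class `recordWrapCtr`,
`(EGZ x).piece X φ = EG x n X φ`.  The hand's `EG` is `g3cEG` = the walk pieces `g3cW` COLLECTED at `X_full`; since ✓`g3cFull_mem_recordWrapCtr` (✓`…PortS1G3CCollect` :91 — the cube with all
indices `⌊q∕2⌋` is on the antipodal seam) the collector's seat is IN the wrap class, so off it `g3cEG … X φ = g3cW … X φ` (✓`G3CInv.collect_of_ne`) and the twin to build is the twin of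
`g3cW`.  This file writes that twin on the integer fluctuation index `TwinIdx F Mc X̂` of ✓`…LZdetTwinObjects`, mirroring the hand's objects letter for letter:
* `twinCube` (the `Mc`-cube `⌊ẑ∕(L·Mc)⌋` of an integer index), `g3cBlkZ q̂ := collar (block q̂)` (the `5^4` cubes `□̃` of [B13]), `g3cLocOpZ` (`T^{(Ẑ)} := Σ_{Ŷ ⊆ Ẑ} TZ_Ŷ`), `g3cLocBlockZ`
  (`x·1 + T^{(Ẑ)}|_Ẑ`), `g3cLocInvZ` (its inverse extended by zero), `g3cProjZ`, `g3cIndZ` (cube-diagonal projections), `g3cStepZ`, `g3cStepMZ`, `g3cWalkTermZ`, `g3cWalkLocZ`, `g3cWmZ`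
  (finite sums over `q̂₀ ∈ X̂`, `ŵ ∈ piFinset (X̂ ×ˢ 𝒫 X̂)`), `g3cWZ x : IntFormula` (`Σ'_m (−1)^m W_m`);
* §2 the elementary API (`g3cStepMZ_of_subset ∕ _of_not_subset`, support of `g3cLocInvZ`, the diagonal entries).
Locality ∕ invariance (`…G3CTwinLocal`) and the off-wrap bridge to `g3cW` (`…G3CTwinBridge`, via ✓`twinIdxEquiv` ∕ ✓`twinMat_eq_reindex`) are the companion files.

HONEST FRAMING.  Definitions only (bookkeeping of [B9] (3.87)–(3.90) on the integer index); NOTHING of Bałaban's estimates asserted, ported or discharged; `stub_G3C` OPEN (its inhabitant is the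
hand's (α)–(δ)); 27930 OPEN · no claim; NODE O 0∕1; COUNT 8∕28 · K 1∕4 UNMOVED; finite `𝕋⁴_{L^K}` at fixed ε — NOT continuum ∕ OS ∕ Clay; **the Yang–Mills mass gap is NOT proved by any of
this.**  No `sorry`, no `instance`, no `notation`; standard axioms.
-/

noncomputable section

open scoped BigOperators
open Finset

namespace Summit.QuantumFields.YangMills.Theorems.BalabanUVNodesPortS1

open Summit.QuantumFields.YangMills.Theorems.K0RecordFormatNames
open Literature.MathematicalPhysics.QuantumFieldTheory.Balaban1983to89
open Literature.MathematicalPhysics.QuantumFieldTheory.Balaban1983to89.Node00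
open Literature.MathematicalPhysics.QuantumFieldTheory.Balaban1983to89.T4Continuum (T4Family)
open Literature.MathematicalPhysics.QuantumLattice (blockMap blockSites mem_blockSites_iff)

/-! ## §1  The integer walk objects -/

section Defs

variable (F : T4Family)

/-- **The `Mc`-cube of an integer fluctuation index**: `⌊ẑ ∕ (L·Mc)⌋` for the source `ẑ` of its bond (an element of `X̂` for indices of `TwinIdx F Mc X̂`). [cite: Balaban1987RG1, (1.21) p.264 (bookkeeping)] -/
def twinCube (Mc : ℕ) {Xh : Finset (Fin 4 → ℤ)} (i : TwinIdx F Mc Xh) : Fin 4 → ℤ :=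
  blockMap (F.L * Mc) i.2.1.1

/-- **`□̃` on the integer cube lattice**: the `5^4` cubes `collar (block q̂)` = `{ŷ : |ŷ_i − q̂_i| ≤ 2}` (the print's block `□̃` of side `(1 + 2·2)·M`). [cite: Balaban1987RG1, p.257; Balaban1985BackgroundPropagators, (3.87) p.409] -/
def g3cBlkZ (q : Fin 4 → ℤ) : Finset (Fin 4 → ℤ) :=
  B13ScaleTransfer.collar (B13ScaleTransfer.block q)

/-- **`T^{(Ẑ)}(f) := Σ_{Ŷ ⊆ Ẑ} TZ_Ŷ(f)`** on the integer fluctuation index of `X̂`. [cite: Balaban1987RG1, (1.7) p.261; Balaban1985UV3, (24) p.262] -/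
def g3cLocOpZ (Mc : ℕ) (TZY : Finset (Fin 4 → ℤ) → IntBondCfg → ((Fin 4 → ℤ) × Fin 4) × Fin 3 → ((Fin 4 → ℤ) × Fin 4) × Fin 3 → ℂ)
    (Xh Zh : Finset (Fin 4 → ℤ)) (f : IntBondCfg) : Matrix (TwinIdx F Mc Xh) (TwinIdx F Mc Xh) ℂ :=
  ∑ Yh ∈ Zh.powerset, twinMat F Mc TZY Xh Yh f

/-- **The restricted block `x·1 + T^{(Ẑ)}(f)|_Ẑ`** on the integer indices whose cube lies in `Ẑ`. [cite: Balaban1985UV3, p.272; Balaban1985BackgroundPropagators, (3.42) p.399] -/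
def g3cLocBlockZ (Mc : ℕ) (TZY : Finset (Fin 4 → ℤ) → IntBondCfg → ((Fin 4 → ℤ) × Fin 4) × Fin 3 → ((Fin 4 → ℤ) × Fin 4) × Fin 3 → ℂ)
    (Xh Zh : Finset (Fin 4 → ℤ)) (x : ℝ) (f : IntBondCfg) :
    Matrix {i : TwinIdx F Mc Xh // twinCube F Mc i ∈ Zh} {i : TwinIdx F Mc Xh // twinCube F Mc i ∈ Zh} ℂ :=
  (x : ℂ) • (1 : Matrix _ _ ℂ) +
    (g3cLocOpZ F Mc TZY Xh Zh f).submatrix (Subtype.val : {i : TwinIdx F Mc Xh // twinCube F Mc i ∈ Zh} → TwinIdx F Mc Xh) Subtype.val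

/-- **The integer local inverse `G_Ẑ(x, f)`**: the inverse of the restricted block, extended by zero. [cite: Balaban1985BackgroundPropagators, (3.87)–(3.88) p.409] -/
def g3cLocInvZ (Mc : ℕ) (TZY : Finset (Fin 4 → ℤ) → IntBondCfg → ((Fin 4 → ℤ) × Fin 4) × Fin 3 → ((Fin 4 → ℤ) × Fin 4) × Fin 3 → ℂ)
    (Xh Zh : Finset (Fin 4 → ℤ)) (x : ℝ) (f : IntBondCfg) : Matrix (TwinIdx F Mc Xh) (TwinIdx F Mc Xh) ℂ :=
  fun i j => if hi : twinCube F Mc i ∈ Zh then (if hj : twinCube F Mc j ∈ Zh then (g3cLocBlockZ F Mc TZY Xh Zh x f)⁻¹ ⟨i, hi⟩ ⟨j, hj⟩ else 0) else 0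

/-- **`P_Ẑ`** — the coordinate projection onto the integer indices whose cube lies in `Ẑ`. [cite: Balaban1985BackgroundPropagators, (3.87) p.409] -/
def g3cProjZ (Mc : ℕ) (Xh Zh : Finset (Fin 4 → ℤ)) : Matrix (TwinIdx F Mc Xh) (TwinIdx F Mc Xh) ℂ :=
  Matrix.diagonal fun i => if twinCube F Mc i ∈ Zh then 1 else 0

/-- **`𝟙_□̂`** — the sharp partition: the coordinate projection onto the integer indices whose cube is `q̂`. [cite: Balaban1985BackgroundPropagators, (3.87) p.409] -/
def g3cIndZ (Mc : ℕ) (Xh : Finset (Fin 4 → ℤ)) (q : Fin 4 → ℤ) : Matrix (TwinIdx F Mc Xh) (TwinIdx F Mc Xh) ℂ :=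
  Matrix.diagonal fun i => (((if twinCube F Mc i = q then (1 : ℝ) else 0) : ℝ) : ℂ)

/-- **The integer step matrix `S_{□̂,Ŷ} := TZ_Ŷ · P_□̃ · G_□̃ · 𝟙_□̂`.** [cite: Balaban1985BackgroundPropagators, (3.88) p.409] -/
def g3cStepZ (Mc : ℕ) (TZY : Finset (Fin 4 → ℤ) → IntBondCfg → ((Fin 4 → ℤ) × Fin 4) × Fin 3 → ((Fin 4 → ℤ) × Fin 4) × Fin 3 → ℂ)
    (Xh : Finset (Fin 4 → ℤ)) (q : Fin 4 → ℤ) (Yh : Finset (Fin 4 → ℤ)) (x : ℝ) (f : IntBondCfg) : Matrix (TwinIdx F Mc Xh) (TwinIdx F Mc Xh) ℂ :=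
  twinMat F Mc TZY Xh Yh f * g3cProjZ F Mc Xh (g3cBlkZ q) * g3cLocInvZ F Mc TZY Xh (g3cBlkZ q) x f * g3cIndZ F Mc Xh q

/-- **Admissible integer step matrix** `S^M_{□̂,Ŷ} := S_{□̂,Ŷ}` if `Ŷ ⊄ □̃`, `:= 0` otherwise. [cite: Balaban1985BackgroundPropagators, (3.88) p.409] -/
def g3cStepMZ (Mc : ℕ) (TZY : Finset (Fin 4 → ℤ) → IntBondCfg → ((Fin 4 → ℤ) × Fin 4) × Fin 3 → ((Fin 4 → ℤ) × Fin 4) × Fin 3 → ℂ)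
    (Xh : Finset (Fin 4 → ℤ)) (x : ℝ) (f : IntBondCfg) (s : (Fin 4 → ℤ) × Finset (Fin 4 → ℤ)) : Matrix (TwinIdx F Mc Xh) (TwinIdx F Mc Xh) ℂ :=
  if s.2 ⊆ g3cBlkZ s.1 then 0 else g3cStepZ F Mc TZY Xh s.1 s.2 x f

/-- **The integer walk term** `t(□̂₀, ŵ) := Tr[G_{□̃₀}·𝟙_{□̂₀}·S^M(ŵ₀)⋯S^M(ŵ_{m−1})]`. [cite: Balaban1985BackgroundPropagators, (3.90) p.409; Balaban1985UV3, (25) p.262] -/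
def g3cWalkTermZ (Mc : ℕ) (TZY : Finset (Fin 4 → ℤ) → IntBondCfg → ((Fin 4 → ℤ) × Fin 4) × Fin 3 → ((Fin 4 → ℤ) × Fin 4) × Fin 3 → ℂ)
    (Xh : Finset (Fin 4 → ℤ)) (x : ℝ) (f : IntBondCfg) (q₀ : Fin 4 → ℤ) {m : ℕ} (w : Fin m → (Fin 4 → ℤ) × Finset (Fin 4 → ℤ)) : ℂ :=
  (g3cLocInvZ F Mc TZY Xh (g3cBlkZ q₀) x f * g3cIndZ F Mc Xh q₀ * (List.ofFn fun i => g3cStepMZ F Mc TZY Xh x f (w i)).prod).trace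

/-- **The localization of an integer walk** `X̂(□̂₀, ŵ) := □̃₀ ∪ ⋃_i (Ŷ_i ∪ □̃_i)`. [cite: Balaban1987RG1, (1.7) p.261; Balaban1985UV3, p.262] -/
def g3cWalkLocZ (q₀ : Fin 4 → ℤ) {m : ℕ} (w : Fin m → (Fin 4 → ℤ) × Finset (Fin 4 → ℤ)) : Finset (Fin 4 → ℤ) :=
  g3cBlkZ q₀ ∪ Finset.univ.biUnion fun i : Fin m => (w i).2 ∪ g3cBlkZ (w i).1

/-- **`Ŵ_m`** — the integer formula of the length-`m` walks: on `X̂`, the sum of the walk terms with start cube in `X̂`, steps in `X̂ × 𝒫 X̂`, and localization exactly `X̂`.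
[cite: Balaban1987RG1, (1.7) p.261, (1.21) p.264; Balaban1985BackgroundPropagators, (3.90) p.409] -/
def g3cWmZ (Mc : ℕ) (TZY : Finset (Fin 4 → ℤ) → IntBondCfg → ((Fin 4 → ℤ) × Fin 4) × Fin 3 → ((Fin 4 → ℤ) × Fin 4) × Fin 3 → ℂ) (x : ℝ) (m : ℕ) : IntFormula :=
  fun Xh f => ∑ q₀ ∈ Xh, ∑ w ∈ Fintype.piFinset (fun _ : Fin m => Xh ×ˢ Xh.powerset),
    if g3cWalkLocZ q₀ w = Xh then g3cWalkTermZ F Mc TZY Xh x f q₀ w else 0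

/-- **`Ŵ := Σ'_m (−1)^m Ŵ_m`** — THE INTEGER TWIN of the localized walk pieces `g3cW` (and, off the wrap class, of `g3cEG`): the candidate `EGZ x` of row (gZ).
[cite: Balaban1987RG1, (1.21) p.264; Balaban1985BackgroundPropagators, (3.90) p.409, (3.96) p.411; Balaban1985UV3, (23)–(25) p.262] -/
def g3cWZ (Mc : ℕ) (TZY : Finset (Fin 4 → ℤ) → IntBondCfg → ((Fin 4 → ℤ) × Fin 4) × Fin 3 → ((Fin 4 → ℤ) × Fin 4) × Fin 3 → ℂ) (x : ℝ) : IntFormula :=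
  fun Xh f => ∑' m : ℕ, (-1) ^ m * g3cWmZ F Mc TZY x m Xh f

end Defs

/-! ## §2  Elementary API -/

section API

variable (F : T4Family)
variable (Mc : ℕ) (TZY : Finset (Fin 4 → ℤ) → IntBondCfg → ((Fin 4 → ℤ) × Fin 4) × Fin 3 → ((Fin 4 → ℤ) × Fin 4) × Fin 3 → ℂ)

/-- `□̂ ∈ □̃`. [folklore] -/
theorem mem_g3cBlkZ_self (q : Fin 4 → ℤ) : q ∈ g3cBlkZ q :=
  B13ScaleTransfer.subset_collar _ (B13ScaleTransfer.mem_block_self q)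

/-- Membership in `□̃ = collar (block q̂)`: all index coordinates within `2`. [folklore] -/
theorem mem_g3cBlkZ {q y : Fin 4 → ℤ} : y ∈ g3cBlkZ q ↔ ∀ i, q i - 2 ≤ y i ∧ y i ≤ q i + 2 := by
  unfold g3cBlkZ B13ScaleTransfer.collar
  simp only [Finset.mem_biUnion, B13ScaleTransfer.mem_block]
  constructor
  · rintro ⟨z, hz, hy⟩ i
    obtain ⟨h1, h2⟩ := hz i
    obtain ⟨h3, h4⟩ := hy i
    constructor <;> linarith
  · intro h
    refine ⟨fun i => max (q i - 1) (min (q i + 1) (y i)), fun i => ⟨le_max_left _ _, max_le (by linarith) (min_le_left _ _)⟩, fun i => ⟨?_, ?_⟩⟩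
    · show max (q i - 1) (min (q i + 1) (y i)) - 1 ≤ y i
      obtain ⟨h1, _⟩ := h i
      have hmax : max (q i - 1) (min (q i + 1) (y i)) ≤ max (q i - 1) (y i) := max_le_max le_rfl (min_le_right _ _)
      have : max (q i - 1) (y i) - 1 ≤ y i := by
        rcases le_total (q i - 1) (y i) with hc | hc
        · rw [max_eq_right hc]; linarith
        · rw [max_eq_left hc]; linarith
      linarith
    · show y i ≤ max (q i - 1) (min (q i + 1) (y i)) + 1
      obtain ⟨_, h2⟩ := h i
      have hmin : min (q i + 1) (y i) ≤ max (q i - 1) (min (q i + 1) (y i)) := le_max_right _ _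
      have : y i ≤ min (q i + 1) (y i) + 1 := by
        rcases le_total (q i + 1) (y i) with hc | hc
        · rw [min_eq_left hc]; linarith
        · rw [min_eq_right hc]; linarith
      linarith

/-- The cube of an integer index of `X̂` lies in `X̂`. [cite: Balaban1987RG1, (1.21) p.264 (bookkeeping)] -/
theorem twinCube_mem (hMc : 0 < Mc) {Xh : Finset (Fin 4 → ℤ)} (i : TwinIdx F Mc Xh) : twinCube F Mc i ∈ Xh := by
  classical
  haveI : NeZero (F.L * Mc) := ⟨(Nat.mul_pos (by have := F.hL.2; omega) hMc).ne'⟩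
  have h := i.2.2
  unfold twinBonds at h
  rw [Finset.mem_filter, Finset.mem_product, Finset.mem_biUnion] at h
  obtain ⟨⟨⟨a, ha, hz⟩, _⟩, _⟩ := h
  have : blockMap (F.L * Mc) i.2.1.1 = a := (mem_blockSites_iff _ _ _).1 hz
  unfold twinCube
  rwa [this]

/-- An inadmissible step (`Ŷ ⊆ □̃`) contributes the zero matrix. [cite: Balaban1985BackgroundPropagators, (3.88) p.409] -/
theorem g3cStepMZ_of_subset (Xh : Finset (Fin 4 → ℤ)) (x : ℝ) (f : IntBondCfg) {s : (Fin 4 → ℤ) × Finset (Fin 4 → ℤ)} (h : s.2 ⊆ g3cBlkZ s.1) :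
    g3cStepMZ F Mc TZY Xh x f s = 0 := by
  unfold g3cStepMZ; rw [if_pos h]

/-- An admissible step (`Ŷ ⊄ □̃`) contributes `S_{□̂,Ŷ}`. [cite: Balaban1985BackgroundPropagators, (3.88) p.409] -/
theorem g3cStepMZ_of_not_subset (Xh : Finset (Fin 4 → ℤ)) (x : ℝ) (f : IntBondCfg) {s : (Fin 4 → ℤ) × Finset (Fin 4 → ℤ)} (h : ¬ s.2 ⊆ g3cBlkZ s.1) :
    g3cStepMZ F Mc TZY Xh x f s = g3cStepZ F Mc TZY Xh s.1 s.2 x f := by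
  unfold g3cStepMZ; rw [if_neg h]

/-- **Support of the integer local inverse**: `G_Ẑ i j = 0` unless both cubes lie in `Ẑ`. [cite: Balaban1985BackgroundPropagators, (3.88) p.409] -/
theorem g3cLocInvZ_apply_of_not_mem (Xh Zh : Finset (Fin 4 → ℤ)) (x : ℝ) (f : IntBondCfg) {i j : TwinIdx F Mc Xh}
    (h : twinCube F Mc i ∉ Zh ∨ twinCube F Mc j ∉ Zh) : g3cLocInvZ F Mc TZY Xh Zh x f i j = 0 := by
  unfold g3cLocInvZ
  rcases h with h | h
  · rw [dif_neg h]
  · by_cases hi : twinCube F Mc i ∈ Zh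
    · rw [dif_pos hi, dif_neg h]
    · rw [dif_neg hi]

/-- Entries of the integer local inverse on the indices of `Ẑ`. [cite: Balaban1985BackgroundPropagators, (3.87) p.409] -/
theorem g3cLocInvZ_apply_of_mem (Xh Zh : Finset (Fin 4 → ℤ)) (x : ℝ) (f : IntBondCfg) {i j : TwinIdx F Mc Xh}
    (hi : twinCube F Mc i ∈ Zh) (hj : twinCube F Mc j ∈ Zh) :
    g3cLocInvZ F Mc TZY Xh Zh x f i j = (g3cLocBlockZ F Mc TZY Xh Zh x f)⁻¹ ⟨i, hi⟩ ⟨j, hj⟩ := by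
  unfold g3cLocInvZ
  rw [dif_pos hi, dif_pos hj]

/-- The local operator's entries. [cite: Balaban1987RG1, (1.7) p.261] -/
theorem g3cLocOpZ_apply (Xh Zh : Finset (Fin 4 → ℤ)) (f : IntBondCfg) (i j : TwinIdx F Mc Xh) :
    g3cLocOpZ F Mc TZY Xh Zh f i j = ∑ Yh ∈ Zh.powerset, TZY Yh f (i.2.1, i.1) (j.2.1, j.1) := by
  unfold g3cLocOpZ
  rw [Matrix.sum_apply]
  rfl

/-- If the localization of a walk is `X̂` then its start cube lies in `X̂`. [cite: Balaban1987RG1, (1.7) p.261 (bookkeeping)] -/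
theorem mem_of_g3cWalkLocZ_eq {Xh : Finset (Fin 4 → ℤ)} {q₀ : Fin 4 → ℤ} {m : ℕ} {w : Fin m → (Fin 4 → ℤ) × Finset (Fin 4 → ℤ)}
    (h : g3cWalkLocZ q₀ w = Xh) : q₀ ∈ Xh := by
  rw [← h]; unfold g3cWalkLocZ
  exact Finset.mem_union_left _ (mem_g3cBlkZ_self q₀)

/-- If the localization of a walk is `X̂` then every block `□̃_i` and every `Ŷ_i` lies in `X̂`. [cite: Balaban1987RG1, (1.7) p.261 (bookkeeping)] -/
theorem subset_of_g3cWalkLocZ_eq {Xh : Finset (Fin 4 → ℤ)} {q₀ : Fin 4 → ℤ} {m : ℕ} {w : Fin m → (Fin 4 → ℤ) × Finset (Fin 4 → ℤ)}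
    (h : g3cWalkLocZ q₀ w = Xh) : g3cBlkZ q₀ ⊆ Xh ∧ ∀ i, (w i).2 ⊆ Xh ∧ g3cBlkZ (w i).1 ⊆ Xh := by
  subst h; unfold g3cWalkLocZ
  refine ⟨Finset.subset_union_left, fun i => ⟨?_, ?_⟩⟩
  · exact fun y hy => Finset.mem_union_right _ (Finset.mem_biUnion.2 ⟨i, Finset.mem_univ _, Finset.mem_union_left _ hy⟩)
  · exact fun y hy => Finset.mem_union_right _ (Finset.mem_biUnion.2 ⟨i, Finset.mem_univ _, Finset.mem_union_right _ hy⟩)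

end API

end Summit.QuantumFields.YangMills.Theorems.BalabanUVNodesPortS1

end
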